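import Mathlib
import HarnessLib
import Summits.NavierStokesRegularity.NavierStokesRegularity.Theses.LocalHelicityTubeDoor
import Summits.NavierStokesRegularity.NavierStokesRegularity.Theorems.LocalHelicityTubeDoorLocalPointZoomVelCurlSlices

/-!
# Route `LocalHelicityTubeDoor` (S11, rung N0-LocalTubeDoorHelicity) — crux K1‴ `LocalPointZoomVelCurlSlices` is a THEOREM

Cell ns-regularity-ideate, seat p6 (birth filing; the route was opened from nsreg-p1 g11's staged package
HOME/ns-regularity-ideate-p1/route-helicity/).  The crux text is VERBATIM the statement of the tree theorem
`…Theorems.LocalHelicityTubeDoorLocalPointZoomVelCurlSlices.localPointZoomVelCurlSlices` (p437380: one zoom sequence along which the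
rescaled velocities AND the rescaled vorticities converge on every slice to a backward-singular profile of the Type-I class);
this file records it BY NAME against the born Theses decl (closing item stmt-NavierStokesRegularity-19976).

WHAT THIS IS NOT: not a claim about Navier–Stokes regularity (Clay A) and not the open crux K2⁗.  The leaf is a regularity
CRITERION (local Type I + L¹-fading of the scale-normalised helicity density (T−t)^{3/2}·⟪u, curl u⟫ on ONE similarity
window ⇒ backward bounded) CONDITIONAL on K2⁗ `FrobeniusProfileRigidity` (rigidity of helicity-free Type-I profiles,
OPEN); one rung of LADDER-NS N0 (N0-LocalTubeDoorHelicity); establishment in the cell's sense still requires the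
cross-family referee PASS + independent reproduction.
-/

noncomputable section

-- the summit and its single sub-problem share the name (CONVENTIONS §1), as in every Theorems file
set_option linter.dupNamespace false

namespace Summit.NavierStokesRegularity.NavierStokesRegularity.Theorems.LocalHelicityTubeDoorLocalPointZoomVelCurlSlicesClose

open Summit.NavierStokesRegularity.NavierStokesRegularity.Theorems.LocalHelicityTubeDoorLocalPointZoomVelCurlSlices

/-- **Crux K1‴ `LocalPointZoomVelCurlSlices` (item stmt-NavierStokesRegularity-19976) is a THEOREM**: the born decl unfolds to the
statement of `localPointZoomVelCurlSlices` (p437380). -/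
theorem localPointZoomVelCurlSlices_proof :
    Summit.NavierStokesRegularity.NavierStokesRegularity.Theses.LocalHelicityTubeDoor.LocalPointZoomVelCurlSlices := by
  unfold Summit.NavierStokesRegularity.NavierStokesRegularity.Theses.LocalHelicityTubeDoor.LocalPointZoomVelCurlSlices
  exact localPointZoomVelCurlSlices

end Summit.NavierStokesRegularity.NavierStokesRegularity.Theorems.LocalHelicityTubeDoorLocalPointZoomVelCurlSlicesClose

end
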